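import Summits.BirchSwinnertonDyer.BirchSwinnertonDyer.Theorems.QuadraticBranchSignedControlPlusEtaNonsurjLambdaTransfer
import Summits.BirchSwinnertonDyer.Rank1Residual.Additive.QuadraticBranchPlusLFunctionExistence
import Literature.NumberTheory.EllipticCurves.CorpuzLei2025.PlusEtaAnalyticInvariantsCongruentCurves
import Summits.BirchSwinnertonDyer.BirchSwinnertonDyer.Theorems.QuadraticBranchSignedControlTwistPartnerModel
import Literature.NumberTheory.EllipticCurves.ModularityVersionApProofs
import Literature.NumberTheory.EllipticCurves.BSDConductorProofs
import Literature.NumberTheory.EllipticCurves.LFunctionPrimeCoeff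
import HarnessLib

/-!
# Route `QuadraticBranchSignedControl` (rung K8, cell `bsd-potss`), residual crux `PlusEtaMainConjectureNonsurj`
# (stmt-BirchSwinnertonDyer-19606): Part XLVI — **THE PREPRINT BINDER OF SKELETON v7 IS A THEOREM MODULO CITE-LEVEL
# INVARIANT FACTS**: `CorpuzLei2025_etaPlusMainConjecture_transfer_anMu_OPEN` (= `Sig.stub_etaMC_transferCL25`) FOLLOWS from
# Hatley–Lei 2019 Thm. 4.6 + Prop. 5.1 (algebraic `μ`/`λ` transfer, PUBLISHED), Corpuz–Lei Thm. 5.3 (analytic `μ`/`λ` transfer,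
# accepted / to appear Math. Z.), Kobayashi Thm. 2.2η / 4.1η, modularity, the existence of a `p`-integral period ratio, and
# Part XLV's Greenberg–Vatsal squeeze (seat `bsd-potss-k8eta-c2` g33; kernel; CONDITIONAL on the displayed named facts)

WHY. Skeleton v7 (`Cruxes/PlusEtaMainConjectureNonsurj/Lines/birth.lean`) carries `stub_etaMC_transferCL25 :=
CorpuzLei2025_etaPlusMainConjecture_transfer_anMu_OPEN`, an `@[conjecture]`-level COMPOSITE of Corpuz–Lei's Thms 5.3 + 5.9 + 5.10 at
`i = (p−1)/2` whose reading requires the «IMC dictionary» (flag `CL25-eta-plus-dictionary` on "Conjecture (IMC) for `𝒳^♮(f)^{ω^i}`").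
Part XLV proved the kernel of Thm. 5.10 (the squeeze). THIS FILE closes the loop: the binder, BY NAME, from
(i) `HatleyLei2019.thm46_prop51_etaSignedMuLambda_transfer_of_torsionIso` (p775095; Thm. 5.9's source, published 2019),
(ii) `CorpuzLei2025.thm53_etaPlusAnalyticMuLambda_transfer_of_torsionIso` (p775217; reviewed), (iii) Kobayashi Thm. 2.2η / 4.1η,
(iv) modularity `exists_isNewformOf`, (v) ONE displayed existence input `hper`: every good `a_p = 0` curve has a `p`-INTEGRAL period ratio
of the parity of `η` (at `p ≡ 1 (mod 4)` this is Greenberg–Vatsal §3 Rem. 3.4 = the tree's named fact `realPeriodRat_eq_unit_mul_plusPeriod`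
through `exists_padicNorm_eq_one_mul_realPeriodRat_eq_plusPeriod_of_goodSupersingular`; at `p ≡ 3 (mod 4)` the tree has no minus-period
fact — hence displayed), used ONLY to know that the anchor `V′` HAS a branch function `L_p⁺(V′, η, X)` (`exists_isQuadraticBranchPlusLFunction_of_isNewformOf`)
so that the binder's ∀-hypotheses at `V′` are not vacuous. So the binder's epistemic status moves from «unrefereed composite with an IMC
dictionary» to «two invariant-level cite facts (one published, one accepted) + modularity + a period-integrality input»; the planner may
re-cut `stub_etaMC_transferCL25` into `stub_etaMC_publishedInputs`. The statement of the binder is UNCHANGED (proved by name).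

MATHEMATICS. For the binder's data (`V`, `V′`, `p ≠ 2`, `e : V′[p] ≃ V[p]`, (C1⁺_η)(V′), `μ_an(V′) = 0`) and a frame + `(f, ϖ, Lη)` + datum
`D` of `V`: (1) globally minimal `η`-twists `W`, `W′` EXIST (the tree's `TwistPartner.exists_isGloballyMinimal_twistPartner`); (2) `Σ₀ :=` the finite set of places where `V` or `V′` is bad (finite: they divide
`N_V N_V′`); (3) the anchor's `(f′, ϖ′, Lη′)` EXIST (`hnf`, `hper`, Pollack/Kobayashi existence PROVED in the tree); (4) `μ_an(V′) = 0` on `Lη′`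
(binder hypothesis) ⟹ by Thm. 5.3: `Lη` has unit content and `ord(Lη mod p) + Σδ(W) = ord(Lη′ mod p) + Σδ(W′)`, i.e. (Part XLV §131)
`λ(Lη) + Σδ(W) = λ(Lη′) + Σδ(W′)`; (5) Part XLV §134: every anchor datum has `(μ, λ) = (0, λ(Lη′))`; (6) Part XLV §132 (its `p ≠ 2` twin
§136 here, since §132 was filed with `5 ≤ p`): `Char(D.X) = (Lη)`.

HONEST FRAMING (cell `bsd-potss`; FULL-BSD rank ≤ 1 programme, HUMAN RULING D-0036/D-0074): TOOL THEOREMS ONLY — no definition, no named fact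
minted here, no `sorry`, axioms standard. The binder is proved BY NAME but CONDITIONALLY on the displayed named facts (`h46 h53 h22 h41 hnf`) and
the displayed period input `hper`; Corpuz–Lei is accepted-forthcoming (flag `CL25-forthcoming`), its dictionary flags ride along
(`CL25-eta-plus-dictionary`, `CL25-period-normalisation`, `Kob03-Lpm-eta-upto-unit`). No stub of 19606 is CLOSED (stubs close only
unconditionally); the crux and the route stay OPEN; nothing is booked; `BSD(W, p)` is claimed for no pair. `--supports stmt-BirchSwinnertonDyer-19606`.

References: [CorpuzLei2025] Thms 5.3 / 5.9 / 5.10, Prop. 5.8; [HatleyLei2019] Thm. 4.6, Prop. 5.1, Cor. 5.2; [GreenbergVatsal2000] p. 4, §3 Rem. 3.4;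
[Kobayashi2003] Thm. 2.2, 3.2, §4 + Thm. 4.1; [SilvermanAEC2009] VIII.8 Cor. 8.3 (global minimal models), X.5 (twists); [DiamondShurman2005] §8.3.
Tree: Part XLV (`EtaLambdaTransfer`), `exists_isQuadraticBranchPlusLFunction_of_isNewformOf`, `dvd_conductorNorm_iff`,
`hasGoodReductionAtPrime_primesEquiv_iff_holds`, `natCast_mem_asIdeal_iff_eq_primesEquiv_symm`.
-/

set_option autoImplicit false
set_option linter.dupNamespace false
noncomputable section

open scoped Classical

open NumberField IsDedekindDomain CongruenceSubgroup Field WeierstrassCurve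
open Literature.NumberTheory.EllipticCurves
open Literature.NumberTheory.EllipticCurves.ModularForms
open Literature.NumberTheory.GaloisRepresentations
open Literature.NumberTheory.EllipticCurves.IwasawaAlgebra
open Literature.NumberTheory.EllipticCurves.GreenbergVatsal2000
open ZpExtension
open Summit.BirchSwinnertonDyer.Rank1Residual.Additive
open Summit.BirchSwinnertonDyer.Rank1Residual.X1.MuLambda
open Summit.BirchSwinnertonDyer.Rank1Residual.X1.ParitySqueeze (lam_generator_eq_lambdaInvariant)
open Summit.BirchSwinnertonDyer.Rank1Residual.X1.MuPart (mu_generator_eq_muInvariant)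
open Summit.BirchSwinnertonDyer.Rank1Residual.X11a (mu_eq_zero_of_hasUnitContent hasUnitContent_of_mu_eq_zero)
open Summit.BirchSwinnertonDyer.BirchSwinnertonDyer.Theorems.EtaThetaFunctionalEquation (natCast_pow_mul_mem_span_singleton_iff)

namespace Summit.BirchSwinnertonDyer.BirchSwinnertonDyer.Theorems.EtaLambdaTransfer

/-! ## §135 Existence glue: the finite set of bad places (the globally minimal `η`-twists are the tree's `TwistPartner.exists_isGloballyMinimal_twistPartner`) -/

section Glue

variable {p : ℕ} [hp : Fact p.Prime]

/-- **The finite set `Σ₀` of finite places where `V` or `V′` has bad reduction** (they divide `N_V · N_V′`; Diamond–Shurman §8.3: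
`ℓ ∣ N_E` iff bad reduction), with the three membership facts the transfer facts consume: exact membership, `(p) ∉ Σ₀` when both
curves are good at `p`, and good reduction off `Σ₀`. [cite: DiamondShurman2005, §8.3] -/
theorem exists_finset_badPlaces (V V' : WeierstrassCurve ℚ) [V.IsElliptic] [V'.IsElliptic]
    (hgood : V.HasGoodReductionAtPrime p) (hgood' : V'.HasGoodReductionAtPrime p) :
    ∃ S₀ : Finset (HeightOneSpectrum (𝓞 ℚ)),
      (∀ w : HeightOneSpectrum (𝓞 ℚ), w ∈ S₀ ↔ (¬ V.HasGoodReductionAt w ∨ ¬ V'.HasGoodReductionAt w)) ∧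
      (∀ w ∈ S₀, ((p : ℕ) : 𝓞 ℚ) ∉ w.asIdeal) ∧
      (∀ w : HeightOneSpectrum (𝓞 ℚ), w ∉ S₀ → ((p : ℕ) : 𝓞 ℚ) ∉ w.asIdeal → V.HasGoodReductionAt w) ∧
      (∀ w : HeightOneSpectrum (𝓞 ℚ), w ∉ S₀ → ((p : ℕ) : 𝓞 ℚ) ∉ w.asIdeal → V'.HasGoodReductionAt w) := by
  -- finiteness: a bad place divides `N_V N_V'`
  set n : ℕ := V.conductorNorm ℤ * V'.conductorNorm ℤ with hn
  have hn0 : n ≠ 0 := mul_ne_zero (V.conductorNorm_pos_holds).ne' (V'.conductorNorm_pos_holds).ne'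
  have hI : Ideal.span {((n : ℕ) : 𝓞 ℚ)} ≠ 0 := by
    rw [Ideal.zero_eq_bot, Ne, Ideal.span_singleton_eq_bot]; exact_mod_cast hn0
  have hfin : {w : HeightOneSpectrum (𝓞 ℚ) | ¬ V.HasGoodReductionAt w ∨ ¬ V'.HasGoodReductionAt w}.Finite := by
    refine (Ideal.finite_factors hI).subset ?_
    intro w hw
    simp only [Set.mem_setOf_eq] at hw ⊢
    rw [Ideal.dvd_span_singleton]
    have hℓw : ((Rat.HeightOneSpectrum.primesEquiv w : ℕ) : 𝓞 ℚ) ∈ w.asIdeal :=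
      (natCast_mem_asIdeal_iff_eq_primesEquiv_symm w (Rat.HeightOneSpectrum.primesEquiv w).2).mpr
        (Equiv.symm_apply_apply _ w).symm
    have hdvd : (Rat.HeightOneSpectrum.primesEquiv w : ℕ) ∣ n := by
      rcases hw with h | h
      · exact ((V.dvd_conductorNorm_iff w).mpr h).trans (dvd_mul_right _ _)
      · exact ((V'.dvd_conductorNorm_iff w).mpr h).trans (dvd_mul_left _ _)
    obtain ⟨c, hc⟩ := hdvd
    rw [hc, Nat.cast_mul]
    exact w.asIdeal.mul_mem_right _ hℓw
  refine ⟨hfin.toFinset, fun w ↦ by rw [Set.Finite.mem_toFinset, Set.mem_setOf_eq], ?_, ?_, ?_⟩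
  · intro w hw hpw
    rw [Set.Finite.mem_toFinset, Set.mem_setOf_eq] at hw
    have hwp : w = (Rat.HeightOneSpectrum.primesEquiv (R := 𝓞 ℚ)).symm ⟨p, hp.out⟩ :=
      (natCast_mem_asIdeal_iff_eq_primesEquiv_symm w hp.out).mp hpw
    have hv : (Rat.HeightOneSpectrum.primesEquiv w : ℕ) = p := by rw [hwp, Equiv.apply_symm_apply]
    rcases hw with h | h
    · exact h ((WeierstrassCurve.hasGoodReductionAtPrime_primesEquiv_iff_holds V w p hv).mp hgood)
    · exact h ((WeierstrassCurve.hasGoodReductionAtPrime_primesEquiv_iff_holds V' w p hv).mp hgood')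
  · intro w hw _
    rw [Set.Finite.mem_toFinset, Set.mem_setOf_eq, not_or, not_not, not_not] at hw
    exact hw.1
  · intro w hw _
    rw [Set.Finite.mem_toFinset, Set.mem_setOf_eq, not_or, not_not, not_not] at hw
    exact hw.2

end Glue

/-! ## §136 The transfer at a datum for `p ≠ 2` (Part XLV §132 verbatim with `5 ≤ p` relaxed) -/

section Pair

variable {p : ℕ} [hp : Fact p.Prime]

/-- **(C1⁺_η) AT A DATUM BY `λ`-TRANSFER, `p ≠ 2`** — Part XLV's `etaCharIdeal_eq_span_of_lambdaTransfer` with its hypothesis `5 ≤ p`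
relaxed to `p ≠ 2` (the binder quantifies over all odd `p`; the proof uses `p ≠ 2` only). See Part XLV §132 for the chain.
[cite: HatleyLei2019, Thm. 4.6, Prop. 5.1, Cor. 5.2] [cite: Kobayashi2003, Thm. 2.2 (p. 5), Thm. 4.1 (p. 8)] [cite: GreenbergVatsal2000, p. 4] -/
theorem etaCharIdeal_eq_span_of_lambdaTransfer_of_ne_two
    (h46 : HatleyLei2019.thm46_prop51_etaSignedMuLambda_transfer_of_torsionIso)
    (h22 : Kobayashi2003.thm22_etaSignedSelmerDual_finite_torsion)
    (h41 : Kobayashi2003.thm41_plusEtaCharIdeal_dvd)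
    {V V'' : WeierstrassCurve ℚ} [V.IsElliptic] [V.IsGloballyMinimal] [V''.IsElliptic] [V''.IsGloballyMinimal]
    (hp2 : p ≠ 2) (hgood : V.HasGoodReductionAtPrime p) (hap : V.frobeniusTrace p = 0)
    (hgood'' : V''.HasGoodReductionAtPrime p) (hap'' : V''.frobeniusTrace p = 0)
    (hcong : ∃ e : geomTorsion V'' (p : ℤ) ≃+ geomTorsion V (p : ℤ),
      ∀ (σ : absoluteGaloisGroup ℚ) (P : geomTorsion V'' (p : ℤ)), e (σ • P) = σ • e P)
    (W W'' : WeierstrassCurve ℚ) [W.IsElliptic] [W.IsGloballyMinimal] [W''.IsElliptic] [W''.IsGloballyMinimal]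
    (C C'' : VariableChange ℚ) (hCV : C • W.quadraticTwist ((-1) ^ (p / 2) * p) = V)
    (hCV'' : C'' • W''.quadraticTwist ((-1) ^ (p / 2) * p) = V'')
    (S₀ : Finset (HeightOneSpectrum (𝓞 ℚ))) (hS₀ : ∀ w ∈ S₀, ((p : ℕ) : 𝓞 ℚ) ∉ w.asIdeal)
    (hS : ∀ w : HeightOneSpectrum (𝓞 ℚ), w ∉ S₀ → ((p : ℕ) : 𝓞 ℚ) ∉ w.asIdeal → V.HasGoodReductionAt w)
    (hS'' : ∀ w : HeightOneSpectrum (𝓞 ℚ), w ∉ S₀ → ((p : ℕ) : 𝓞 ℚ) ∉ w.asIdeal → V''.HasGoodReductionAt w)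
    (K₀ : Type) [Field K₀] [NumberField K₀] [IsCyclotomicExtension {p} ℚ K₀]
    [(galRange (K := ℚ) K₀).Normal] (ηq : absoluteGaloisGroup ℚ →* ℤˣ)
    (hηK : ∀ σ ∈ galRange (K := ℚ) K₀, ηq σ = 1) (hη1 : ηq ≠ 1)
    (κ : ZpExtension ℚ p) (γ : absoluteGaloisGroup ℚ) (hκ : κ.IsCyclotomic) (hγ : κ.IsTopGenerator γ)
    (hγK : γ ∈ galRange (K := ℚ) K₀) (hγc : IsCyclotomicVariable p γ)
    {lamA : ℕ}
    (hA : ∀ D'' : EtaSignedSelmerDualData V'' κ K₀ ℚ_[p] ηq γ 1,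
      muInvariant p D''.X = 0 ∧ lambdaInvariant p D''.X = lamA)
    {N : ℕ} [NeZero N] {f : CuspForm (Gamma0 N) 2} (hf : IsNewformOf V f) (ϖ : ℚ)
    (hϖ : if Even (p / 2) then (ϖ : ℝ) * V.realPeriodRat = plusPeriod f
      else (ϖ : ℝ) * V.imaginaryPeriodRat = minusPeriod f)
    (Lη : IwasawaAlgebra p) (hL : IsQuadraticBranchPlusLFunction f p ϖ Lη)
    (hLμ : HasUnitContent Lη) (hLlam : lam Lη + ∑ w ∈ S₀, delta W p w = lamA + ∑ w ∈ S₀, delta W'' p w)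
    (D : EtaSignedSelmerDualData V κ K₀ ℚ_[p] ηq γ 1) :
    Module.Finite (IwasawaAlgebra p) D.X ∧ Module.IsTorsion (IwasawaAlgebra p) D.X ∧ D.charIdeal = Ideal.span {Lη} := by
  obtain ⟨hfin, htor⟩ := EtaSignedSelmerDualData.finite_isTorsion_of_thm22 h22 hηK hp2 hgood hap hκ hγ hγK D
  haveI : Module.Finite (IwasawaAlgebra p) D.X := hfin
  refine ⟨hfin, htor, ?_⟩
  obtain ⟨DA⟩ := nonempty_etaSignedSelmerDualData_cyclotomic V'' κ K₀ ℚ_[p] ηq 1 hγ hγK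
  obtain ⟨hμA, hlamA⟩ := hA DA
  obtain ⟨hfinA, htorA⟩ := EtaSignedSelmerDualData.finite_isTorsion_of_thm22 h22 hηK hp2 hgood'' hap'' hκ hγ hγK DA
  have hμA' : DA.toLiterature.mu = 0 := hμA
  have hlamA' : DA.toLiterature.lambda = lamA := hlamA
  have hirr : V.HasIrreducibleModPGaloisRep p :=
    hasIrreducibleModPGaloisRep_of_dvd_frobeniusTrace V p hp2
      (not_dvd_minimalDiscriminantInt_of_hasGoodReductionAtPrime' V p hgood) (hap ▸ dvd_zero _)
  have hirr'' : V''.HasIrreducibleModPGaloisRep p :=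
    hasIrreducibleModPGaloisRep_of_dvd_frobeniusTrace V'' p hp2
      (not_dvd_minimalDiscriminantInt_of_hasGoodReductionAtPrime' V'' p hgood'') (hap'' ▸ dvd_zero _)
  obtain ⟨hμD, hlamD⟩ := h46 V'' V p hp2 hgood'' hap'' hgood hap hirr'' hirr hcong W'' W C'' C hCV'' hCV S₀ hS₀ hS'' hS K₀ ηq hηK
    hη1 κ γ hκ hγ hγK 1 DA.toLiterature D.toLiterature hfinA htorA hfin htor hμA'
  rw [hlamA'] at hlamD
  have hμD' : muInvariant p D.X = 0 := hμD
  have hlamD' : lamA + ∑ w ∈ S₀, delta W'' p w = lambdaInvariant p D.X + ∑ w ∈ S₀, delta W p w := hlamD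
  obtain ⟨g, hg⟩ := (charIdeal_isPrincipal_holds p D.X).principal
  have hg' : D.charIdeal = Ideal.span {g} := hg
  obtain ⟨⟨n, hn⟩, -⟩ := h41 p K₀ ηq hηK hη1 V hp2 hgood hap hf ϖ hϖ Lη hL κ γ hκ hγ hγK hγc D.toLiterature hfin htor
  rw [EtaSignedSelmerDualData.charIdeal_toLiterature, hg', natCast_pow_mul_mem_span_singleton_iff] at hn
  have hL0 : Lη ≠ 0 := by
    rintro rfl
    obtain ⟨k, hk⟩ := hLμ
    simp at hk
  have hg0 : g ≠ 0 := by
    rintro rfl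
    obtain ⟨q, hq⟩ := hn
    exact mul_ne_zero (C_pow_ne_zero n) hL0 (by rw [hq, zero_mul])
  have hμg : mu g = 0 := (mu_generator_eq_muInvariant D.X htor hg0 hg').trans hμD'
  have hlamg : lam g = lambdaInvariant p D.X := lam_generator_eq_lambdaInvariant D.X htor hg0 hg'
  have hlamgA : lam g + ∑ w ∈ S₀, delta W p w = lamA + ∑ w ∈ S₀, delta W'' p w := by rw [hlamg]; exact hlamD'.symm
  have hμL : mu Lη = 0 := mu_eq_zero_of_hasUnitContent hLμ
  have hlam : lam g = lam Lη := Nat.add_right_cancel (hlamgA.trans hLlam.symm)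
  rw [hg']
  exact span_eq_of_dvd_C_pow_mul_of_mu_eq_zero_of_lam_eq hL0 hn hμg hμL hlam

end Pair

/-! ## §137 The binder `CorpuzLei2025_etaPlusMainConjecture_transfer_anMu_OPEN` as a theorem -/

section Binder

/-- **THE OPEN BINDER OF SKELETON v7 (`stub_etaMC_transferCL25`) FROM CITE-LEVEL INVARIANT FACTS.** GRANTED (hypothesis position):
Hatley–Lei 2019 Thm. 4.6 + Prop. 5.1 (`h46`, published), Corpuz–Lei Thm. 5.3 (`h53`, accepted / to appear Math. Z.), Kobayashi Thm. 2.2η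
(`h22`) and Thm. 4.1η (`h41`), modularity with level = conductor (`hnf`), and ONE displayed existence input `hper` — every globally minimal
good `a_p = 0` curve has a `p`-INTEGRAL period ratio of the parity of `η` for its newform (Greenberg–Vatsal §3 Rem. 3.4 at `p ≡ 1 (mod 4)`;
no minus-period fact in the tree at `p ≡ 3 (mod 4)`) — **`CorpuzLei2025_etaPlusMainConjecture_transfer_anMu_OPEN` HOLDS**: for congruent
good `a_p = 0` curves `V′ → V` (`p` odd), Kobayashi's even main conjecture at `η` for `V′` together with `μ_an(V′) = 0` implies it for
`V`. Chain: §135 (twists, `Σ₀`), the anchor's `(f′, ϖ′, Lη′)` from `hnf` / `hper` / the PROVED existence of the branch function, Thm. 5.3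
(`μ_an(V) = 0` and the `λ_an`-identity, read through Part XLV's `lam_eq_order_map_residue_of_mu_eq_zero`), Part XLV §134 (anchor
`(μ, λ)_alg = (0, λ(Lη′))`), §136. CONDITIONAL on the displayed facts; the binder's STATEMENT is unchanged; nothing booked.
[claim: CorpuzLei2025, status: under-review] [cite: HatleyLei2019, Thm. 4.6, Prop. 5.1, Cor. 5.2]
[cite: Kobayashi2003, Thm. 2.2 (p. 5), Thm. 3.2 (p. 7), §4 + Thm. 4.1 (p. 8)] [cite: GreenbergVatsal2000, p. 4 and §3 Remark 3.4]
[cite: Wiles1995, Thm. 0.4 (modularity; level = conductor via Carayol)] -/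
theorem corpuzLei2025_etaPlusMainConjecture_transfer_anMu_of_invariantFacts
    (h46 : HatleyLei2019.thm46_prop51_etaSignedMuLambda_transfer_of_torsionIso)
    (h53 : CorpuzLei2025.thm53_etaPlusAnalyticMuLambda_transfer_of_torsionIso)
    (h22 : Kobayashi2003.thm22_etaSignedSelmerDual_finite_torsion)
    (h41 : Kobayashi2003.thm41_plusEtaCharIdeal_dvd)
    (hnf : exists_isNewformOf)
    (hper : ∀ (V' : WeierstrassCurve ℚ) [V'.IsElliptic] [V'.IsGloballyMinimal] (p : ℕ) [Fact p.Prime]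
        {N' : ℕ} [NeZero N'] (f' : CuspForm (Gamma0 N') 2),
        p ≠ 2 → V'.HasGoodReductionAtPrime p → V'.frobeniusTrace p = 0 → IsNewformOf V' f' →
      ∃ ϖ' : ℚ, ‖(ϖ' : ℚ_[p])‖ ≤ 1 ∧
        (if Even (p / 2) then (ϖ' : ℝ) * V'.realPeriodRat = plusPeriod f'
          else (ϖ' : ℝ) * V'.imaginaryPeriodRat = minusPeriod f')) :
    CorpuzLei2025_etaPlusMainConjecture_transfer_anMu_OPEN := by
  intro V V' _ _ _ _ p _ hp2 hgood hap hgood' hap' hcong hMC' hμan' K₀ _ _ _ _ ηq hηK hη1 N _ f _ _ _ hf ϖ hϖ Lη hL κ γ hκ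
    hγ hγK hγc D
  -- (1) globally minimal `η`-twists of `V` and `V'`
  have hd : ((-1 : ℚ) ^ (p / 2) * p) ≠ 0 :=
    mul_ne_zero (pow_ne_zero _ (neg_ne_zero.mpr one_ne_zero)) (Nat.cast_ne_zero.mpr (Fact.out : p.Prime).ne_zero)
  obtain ⟨W, _, _, C, hCV⟩ := TwistPartner.exists_isGloballyMinimal_twistPartner V hd
  obtain ⟨W', _, _, C', hCV'⟩ := TwistPartner.exists_isGloballyMinimal_twistPartner V' hd
  -- (2) the bad places
  obtain ⟨S₀, hmem, hS₀, hS, hS'⟩ := exists_finset_badPlaces (p := p) V V' hgood hgood'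
  -- (3) the anchor's newform, period ratio and branch function
  haveI : NeZero (V'.conductorNorm ℤ) := ⟨(V'.conductorNorm_pos_holds).ne'⟩
  obtain ⟨f', hf'⟩ := hnf V'
  obtain ⟨ϖ', hϖ'1, hϖ'⟩ := hper V' p f' hp2 hgood' hap' hf'
  obtain ⟨Lη', hL'⟩ := exists_isQuadraticBranchPlusLFunction_of_isNewformOf hp2 hf' hgood' hap' ϖ' hϖ'1
  -- (4) the analytic transfer (Thm. 5.3) from `V'` to `V`
  have hμ' : HasUnitContent Lη' := hμan' hf' ϖ' hϖ' Lη' hL'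
  have hL'0 : Lη' ≠ 0 := by
    rintro rfl
    obtain ⟨k, hk⟩ := hμ'
    simp at hk
  have hϖ0 : ϖ ≠ 0 := by
    rintro rfl
    rw [Rat.cast_zero, zero_mul, zero_mul] at hϖ
    by_cases h : Even (p / 2)
    · rw [if_pos h] at hϖ
      exact (IsNewform0.plusPeriod_pos_holds hf.1 hf.coeffField_eq_bot).ne hϖ
    · rw [if_neg h] at hϖ
      exact (IsNewform0.minusPeriod_pos_holds hf.1 hf.coeffField_eq_bot).ne hϖ
  have hL0 : Lη ≠ 0 := IsQuadraticBranchPlusLFunction.ne_zero_of_isNewformOf hp2 hf hgood hϖ0 hL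
  obtain ⟨hμ, hord⟩ := h53 V' V p hp2 hgood' hap' hgood hap hcong W' W C' C hCV' hCV S₀
    (fun w ↦ by rw [hmem w, or_comm]) hf' hf ϖ' ϖ hϖ' hϖ Lη' Lη hL' hL hL'0 hL0 hμ'
  -- read the orders mod `p` as `λ` (both `μ = 0`)
  have hlam' : lam Lη' = (PowerSeries.order (PowerSeries.map (IsLocalRing.residue ℤ_[p]) Lη')).toNat :=
    lam_eq_order_map_residue_of_mu_eq_zero hL'0 (mu_eq_zero_of_hasUnitContent hμ')
  have hlam : lam Lη = (PowerSeries.order (PowerSeries.map (IsLocalRing.residue ℤ_[p]) Lη)).toNat :=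
    lam_eq_order_map_residue_of_mu_eq_zero hL0 (mu_eq_zero_of_hasUnitContent hμ)
  have hLlam : lam Lη + ∑ w ∈ S₀, delta W p w = lam Lη' + ∑ w ∈ S₀, delta W' p w := by
    rw [hlam, hlam']; exact hord.symm
  -- (5) the anchor's algebraic invariants from (C1⁺_η)(V') and (6) the squeeze at `D`
  exact etaCharIdeal_eq_span_of_lambdaTransfer_of_ne_two h46 h22 h41 hp2 hgood hap hgood' hap' hcong W W' C C' hCV hCV'
    S₀ hS₀ hS hS' K₀ ηq hηK hη1 κ γ hκ hγ hγK hγc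
    (fun D'' ↦ anchor_mu_lambda_of_plusEtaMainConjectureAt hp2 hgood' hap' hMC' hf' ϖ' hϖ' Lη' hL' hμ' K₀ ηq hηK hη1 κ γ hκ hγ
      hγK hγc D'')
    hf ϖ hϖ Lη hL hμ hLlam D

end Binder

end Summit.BirchSwinnertonDyer.BirchSwinnertonDyer.Theorems.EtaLambdaTransfer

end
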